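import Summits.CriticalPhenomena.SAWScalingLimit.Theorems.SAWLoopFugacityFlowIsingBoundaryRatioSideCrossSeparationHelpers2
import HarnessLib

/-!
# Side-to-side crossings of the windowed lattice half-annulus separate the inside from the outside
(line `fk-anchor-transfer`, crux `IsingBoundaryRatio`, stmt-CriticalPhenomena-10650)

The planar-topology piece `AnnSideCrossSeparation` (file `…IsingBoundaryRatioRSWMeshDefs.lean`) of the
registered stub `stub_roughHalfAnnulusRSWMesh : RoughHalfAnnulusRSWMeshOf AnnPathSepG`, PROVED
(`annSideCrossSeparation`; helpers in `…SideCrossSeparationHelpers(2).lean`): for the chordal chart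
`φ : ℍ → D` of a Dobrushin domain `(D; a, b)`, `M > 1`,
`ε > 0`, scales `ρ < ρ₀(ε)`, windows `ρ < r₁ ≤ r₂ < Mρ` and all small meshes `δ`, an open walk of
`H = Ω_δ|_Λ` inside the window `annWindow` (annulus sites of chart radius in `[r₁, r₂]`) from its left
rough side to its right rough side (`annSide`: boundary vertices of `Ω_δ` with chart point in `{re < 0}`,
resp. `{0 < re}`) is an `AnnPathSep` separator: its support meets every walk of `H` from the inside
`annIn` (chart radius `≤ ρ`) to the complement of `annIn ∪ annBody` (chart radius `≥ Mρ`).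

Proof (no probability). Let `g` be the Carathéodory extension of `φ⁻¹` to `closure D ∖ {b}`
(`exists_chart_extension`: continuous, injective, `= φ⁻¹` on `D`, real on `∂D ∖ {b}`; from the tree's
disc-form extension `JordanDomain.exists_continuousOn_extension_holds` through the Cayley transform).
Prolong the polyline of the crossing at its two end vertices `u, v` (boundary vertices of `Ω_δ`, hence
corners of non-perfect cells, `exists_not_isPerfect_of_mem_meshBoundary`) by mesh-avoiding access paths
(`Mesh.exists_accessPath`) cut at their first exit from `D` (`exists_firstExit`): a curve `L` in
`closure D`, `6δ`-close to `u`, `v` at its ends, with feet `q_u, q_v ∈ ∂D`. By uniform continuity of `g`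
on the compact `closure D ∖ B(b, d/2)` and the window margins, for small `δ` the chart image `g(L)` lies
in the closed half-annulus `{ρ ≤ |w| ≤ Mρ, im w ≥ 0}` and `g(q_u) < 0 < g(q_v)` are real
(`re_neg_of_near`). A walk of `H` from `annIn` to the outside, cut at its first exit from
`annIn ∪ annBody` (`exists_prefix_darts`), has a polyline whose `g`-image starts in `{|w| ≤ ρ}` and ends
in `{|w| ≥ Mρ}`; trimming (`exists_trimmed_interval`) gives a sub-curve inside the closed half-annulus
from `{|w| = ρ}` to `{|w| = Mρ}`. In the coordinates `log |w| + i arg w` (`pol`, a continuous injection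
of the closed upper half-plane minus `0` onto a strip) the half-annulus is the rectangle
`[log ρ, log Mρ] × [0, π]`, `g(L)` joins its horizontal sides and the trimmed curve its vertical sides,
so they meet (Maehara's crossing lemma `exists_mem_of_crossing`, `PlaneTopology/Brouwer.lean`); `pol`
and `g` being injective, `L` meets the polyline of the walk. A common point lies on two closed edges of
`δℤ²`, which then share a lattice endpoint (`exists_common_endpoint`), or is the mesh point of `u`/`v`,
or is a mesh-avoiding point of an access path on a mesh edge (impossible): in all cases the walk visits
a vertex of the crossing. Touching of `∂D` by either polyline is harmless (no cross-cut theorem is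
used).

References: R. Maehara, Amer. Math. Monthly 91 (1984) (crossing lemma); Ch. Pommerenke, *Boundary
Behaviour of Conformal Maps* (1992), Thm. 2.6 (Carathéodory) [`PommerenkeBBCM1992`].
-/

noncomputable section

open scoped Classical Topology
open Filter Set Metric SimpleGraph Complex
open Literature.Probability.LatticeModels Literature.Probability.RandomPlanarGeometry
open Literature.Probability.Percolation (BondConfig)
open Literature.Topology.PlaneTopology
open UpperHalfPlane (upperHalfPlaneSet)

namespace Summit.CriticalPhenomena.SAWScalingLimit.Theorems.IsingBoundaryRatio

/-! ### The separation theorem -/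

set_option maxHeartbeats 1000000 in
/-- **Side-to-side crossings of the windowed lattice half-annulus separate the inside from the
outside** (`AnnSideCrossSeparation`). [folklore] -/
theorem annSideCrossSeparation : AnnSideCrossSeparation := by
  intro D φ hφ M hM ε hε
  have hM0 : 0 < M := one_pos.trans hM
  obtain ⟨r, hr, hball⟩ := Metric.tendsto_nhdsWithin_nhds.1 hφ.1 ε hε
  refine ⟨r / M, div_pos hr hM0, fun ρ r₁ r₂ hρ hρr h1 h12 h2 => ?_⟩
  have hMr : M * ρ < r := by rwa [lt_div_iff₀ hM0, mul_comm] at hρr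
  have hMρ : 0 < M * ρ := mul_pos hM0 hρ
  obtain ⟨g, hgc, hgeq, hgreal, hginj, hga⟩ := exists_chart_extension hφ
  -- points of small chart radius lie in the ball and far from `b`
  have hinball : ∀ z ∈ D.carrier, ‖φ.symm z‖ < M * ρ → z ∈ ball (D.pt 0) ε := by
    intro z hz hzr
    have h := hball (φ.symm_mapsTo hz) (by rw [dist_zero_right]; exact hzr.trans hMr)
    rwa [φ.apply_symm_apply hz] at h
  have hcoc := hφ.tendsto_symm_cocompact
  obtain ⟨d, hd, hdball⟩ := Metric.mem_nhdsWithin_iff.1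
    (hcoc ((isCompact_closedBall (0 : ℂ) (M * ρ)).compl_mem_cocompact))
  have hfar : ∀ z ∈ D.carrier, ‖φ.symm z‖ ≤ M * ρ → d ≤ dist z (D.pt 1) := by
    intro z hz hzr
    by_contra h
    push Not at h
    have := hdball ⟨Metric.mem_ball.2 h, hz⟩
    simp only [mem_preimage, mem_compl_iff, mem_closedBall, dist_zero_right, not_le] at this
    linarith
  -- the compact set `B` on which `g` is uniformly continuous
  set B : Set ℂ := closure D.carrier ∩ (ball (D.pt 1) (d / 2))ᶜ with hB
  have hBc : IsCompact B := D.isBounded.isCompact_closure.inter_right isOpen_ball.isClosed_compl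
  have hBsub : B ⊆ closure D.carrier \ {D.pt 1} := by
    rintro z ⟨hz, hzb⟩
    refine ⟨hz, fun h => hzb ?_⟩
    rw [mem_singleton_iff] at h
    rw [h]; exact Metric.mem_ball_self (half_pos hd)
  have hgB : ContinuousOn g B := hgc.mono hBsub
  have hmemB : ∀ z ∈ closure D.carrier, d / 2 ≤ dist z (D.pt 1) → z ∈ B := fun z hz hzd =>
    ⟨hz, fun h => by rw [Metric.mem_ball] at h; linarith⟩
  have hgim : ∀ z ∈ B, 0 ≤ (g z).im := by
    intro z hz
    have hz' := hBsub hz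
    rw [closure_eq_self_union_frontier] at hz'
    rcases hz'.1 with h | h
    · rw [hgeq h]; exact le_of_lt (φ.symm_mapsTo h)
    · exact (hgreal z h hz'.2).ge
  -- the margin `m` and the uniform continuity modulus `η`
  set m : ℝ := min (min (r₁ - ρ) (M * ρ - r₂)) (r₁ / 2) with hm
  have hm0 : 0 < m := lt_min (lt_min (by linarith) (by linarith)) (by linarith)
  have hm1 : m ≤ r₁ - ρ := (min_le_left _ _).trans (min_le_left _ _)
  have hm2 : m ≤ M * ρ - r₂ := (min_le_left _ _).trans (min_le_right _ _)
  have hm3 : 2 * m ≤ r₁ := by linarith [min_le_right (min (r₁ - ρ) (M * ρ - r₂)) (r₁ / 2)]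
  obtain ⟨η, hη, hηg⟩ := Metric.uniformContinuousOn_iff.1 (hBc.uniformContinuousOn_of_continuous hgB) m hm0
  have hδ₀ : 0 < min (η / 6) (d / 14) := lt_min (by positivity) (by positivity)
  filter_upwards [Ioo_mem_nhdsGT hδ₀] with δ hδ Λ
  obtain ⟨hδ0, hδlt⟩ := hδ
  have h6 : 6 * δ < η := by linarith [lt_min_iff.1 hδlt |>.1]
  have h7 : 7 * δ < d / 2 := by linarith [lt_min_iff.1 hδlt |>.2]
  intro H In Ann ω hcross
  obtain ⟨u, hu, v, hv, p, hpW, hpo⟩ := hcross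
  refine ⟨u, v, p, fun z hz => (hpW z hz).1, hpo, fun a₀ b₀ ha₀ hb₀ q => ?_⟩
  by_contra hcon
  push Not at hcon
  -- notation and basic lattice facts
  set emb : Λ → ℂ := fun z => meshPoint δ z.1 with hemb
  have hadj : ∀ {x y : Λ}, H.Adj x y → (discreteDomainGraph D.carrier δ).Adj x.1 y.1 := fun h => h
  have hdartD : ∀ {x y : Λ}, H.Adj x y →
      meshPoint δ x.1 ∈ D.carrier ∧ meshPoint δ y.1 ∈ D.carrier ∧ (zdGraph 2).Adj x.1 y.1 ∧
        segment ℝ (meshPoint δ x.1) (meshPoint δ y.1) ⊆ closure D.carrier ∧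
        x.1 ∈ meshVertices D.carrier δ ∧ y.1 ∈ meshVertices D.carrier δ ∧
        (meshGraph D.carrier δ).Adj x.1 y.1 ∧ dist (meshPoint δ y.1) (meshPoint δ x.1) ≤ δ := by
    intro x y h
    obtain ⟨hm, hx, hy⟩ := discreteDomainGraph_adj_iff.1 (hadj h)
    obtain ⟨hzd, hseg⟩ := meshGraph_adj_iff.1 hm
    have hxv := meshDomain_subset_meshVertices _ _ hx
    have hyv := meshDomain_subset_meshVertices _ _ hy
    refine ⟨hxv, hyv, hzd, hseg, hxv, hyv, hm, ?_⟩
    rw [_root_.dist_comm]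
    have := (Literature.Probability.Percolation.dist_meshPoint_of_adj (δ := δ) hzd).le
    rwa [abs_of_pos hδ0] at this
  -- a vertex whose mesh point lies on the polyline of a walk of positive length is on the walk
  have hvert : ∀ {x y : Λ} (w : H.Walk x y), 0 < w.length → ∀ (c : Λ),
      meshPoint δ c.1 ∈ range (walkPath emb w) → c ∈ w.support ∧ meshPoint δ c.1 ∈ D.carrier := by
    intro x y w hw c hc
    obtain ⟨e, he, hce⟩ := exists_dart_of_mem_range_walkPath w hw hc
    obtain ⟨hxD, hyD, hzd, -⟩ := hdartD e.adj
    rcases Mesh.eq_or_eq_of_meshPoint_mem_segment hδ0 hzd hce with h | h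
    · have : c = e.fst := Subtype.ext h
      rw [this]; exact ⟨w.dart_fst_mem_support_of_mem_darts he, hxD⟩
    · have : c = e.snd := Subtype.ext h
      rw [this]; exact ⟨w.dart_snd_mem_support_of_mem_darts he, hyD⟩
  -- points of the polyline of a walk through vertices of chart radius `< Mρ`... are in `B`
  have hpolyB : ∀ {x y : Λ} (w : H.Walk x y), 0 < w.length →
      (∀ e ∈ w.darts, ‖φ.symm (meshPoint δ e.fst.1)‖ ≤ M * ρ) →
      ∀ z ∈ range (walkPath emb w), ∃ e ∈ w.darts, z ∈ segment ℝ (meshPoint δ e.fst.1) (meshPoint δ e.snd.1) ∧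
        z ∈ B ∧ dist z (meshPoint δ e.fst.1) < η ∧ meshPoint δ e.fst.1 ∈ B := by
    intro x y w hw hrad z hz
    obtain ⟨e, he, hze⟩ := exists_dart_of_mem_range_walkPath w hw hz
    obtain ⟨hxD, hyD, hzd, hseg, -, -, -, hdist⟩ := hdartD e.adj
    have hxb : d ≤ dist (meshPoint δ e.fst.1) (D.pt 1) := hfar _ hxD (hrad e he)
    have hzx : dist z (meshPoint δ e.fst.1) ≤ δ :=
      (convex_closedBall _ _).segment_subset (mem_closedBall_self hδ0.le) (mem_closedBall.2 hdist) hze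
    refine ⟨e, he, hze, hmemB z (hseg hze) ?_, by linarith, hmemB _ (subset_closure hxD) (by linarith)⟩
    linarith [dist_triangle (meshPoint δ e.fst.1) z (D.pt 1), _root_.dist_comm z (meshPoint δ e.fst.1)]
  -- the crossing `p`: its vertices are in the window, it has positive length
  obtain ⟨⟨huA, hur₁, hur₂⟩, hubd, hure⟩ := hu
  obtain ⟨⟨hvA, hvr₁, hvr₂⟩, hvbd, hvre⟩ := hv
  simp only [if_true] at hure
  simp only [if_false, Bool.false_eq_true] at hvre
  have hp0 : 0 < p.length := by
    rcases Nat.eq_zero_or_pos p.length with h | h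
    · exfalso
      have huv : u = v := Walk.eq_of_length_eq_zero h
      rw [huv] at hure
      linarith
    · exact h
  have huD : meshPoint δ u.1 ∈ D.carrier := meshDomain_subset_meshVertices _ _ hubd.1
  have hvD : meshPoint δ v.1 ∈ D.carrier := meshDomain_subset_meshVertices _ _ hvbd.1
  have hprad : ∀ e ∈ p.darts, ‖φ.symm (meshPoint δ e.fst.1)‖ ≤ M * ρ := fun e he =>
    ((hpW _ (p.dart_fst_mem_support_of_mem_darts he)).2.2.trans h2.le)
  have hpwin : ∀ e ∈ p.darts, r₁ ≤ ‖φ.symm (meshPoint δ e.fst.1)‖ ∧ ‖φ.symm (meshPoint δ e.fst.1)‖ ≤ r₂ :=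
    fun e he => (hpW _ (p.dart_fst_mem_support_of_mem_darts he)).2
  -- chart bounds along the polyline of `p`
  have hpchart : ∀ z ∈ range (walkPath emb p), z ∈ B ∧ ρ ≤ ‖g z‖ ∧ ‖g z‖ ≤ M * ρ := by
    intro z hz
    obtain ⟨e, he, hze, hzB, hzd, hxB⟩ := hpolyB p hp0 hprad z hz
    obtain ⟨hxD, -⟩ := hdartD e.adj
    have hg := hηg z hzB _ hxB hzd
    rw [hgeq hxD, dist_eq_norm] at hg
    obtain ⟨hw1, hw2⟩ := hpwin e he
    refine ⟨hzB, ?_, ?_⟩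
    · have := norm_sub_norm_le (φ.symm (meshPoint δ e.fst.1)) (g z)
      rw [← norm_neg, neg_sub] at hg
      linarith
    · have := norm_sub_norm_le (g z) (φ.symm (meshPoint δ e.fst.1))
      linarith
  -- the connectors at `u` and `v`
  have hconn : ∀ (c : Λ), meshPoint δ c.1 ∈ D.carrier → c.1 ∈ meshBoundary D.carrier δ →
      r₁ ≤ ‖φ.symm (meshPoint δ c.1)‖ → ‖φ.symm (meshPoint δ c.1)‖ ≤ r₂ →
      ∃ (qc : ℂ) (Q : Path (meshPoint δ c.1) qc), qc ∈ frontier D.carrier ∧ qc ∈ B ∧ (g qc).im = 0 ∧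
        dist (g qc) (φ.symm (meshPoint δ c.1)) < m ∧
        (∀ z ∈ range Q, z ∈ B ∧ ρ ≤ ‖g z‖ ∧ ‖g z‖ ≤ M * ρ) ∧
        ∀ z ∈ range Q, z ≠ meshPoint δ c.1 → Mesh.AvoidsMesh D.carrier δ z := by
    intro c hcD hcbd hcr₁ hcr₂
    obtain ⟨qc, Q, hq, hQD, hQd, hQA⟩ := exists_connector D.toJordanDomain hδ0 hcbd
    have hcb : d ≤ dist (meshPoint δ c.1) (D.pt 1) := hfar _ hcD (hcr₂.trans h2.le)
    have hcB : meshPoint δ c.1 ∈ B := hmemB _ (subset_closure hcD) (by linarith)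
    have hzB : ∀ z ∈ range Q, z ∈ B ∧ dist (g z) (φ.symm (meshPoint δ c.1)) < m := by
      intro z hz
      have hzcl : z ∈ closure D.carrier := by
        obtain ⟨t, rfl⟩ := hz
        rcases hQD t with h | h
        · exact subset_closure h
        · rw [h]; exact frontier_subset_closure hq
      have hzd := hQd z hz
      have hzB : z ∈ B := hmemB z hzcl (by
        linarith [dist_triangle (meshPoint δ c.1) z (D.pt 1), _root_.dist_comm z (meshPoint δ c.1)])
      refine ⟨hzB, ?_⟩
      have := hηg z hzB _ hcB (by linarith)
      rwa [hgeq hcD] at this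
    have hqr : qc ∈ range Q := ⟨1, Q.target⟩
    obtain ⟨hqB, hqd⟩ := hzB qc hqr
    have hqb : qc ≠ D.pt 1 := (hBsub hqB).2
    refine ⟨qc, Q, hq, hqB, hgreal qc hq hqb, hqd, fun z hz => ?_, hQA⟩
    obtain ⟨hzB', hzd⟩ := hzB z hz
    rw [dist_eq_norm] at hzd
    refine ⟨hzB', ?_, ?_⟩
    · have := norm_sub_norm_le (φ.symm (meshPoint δ c.1)) (g z)
      rw [← norm_neg, neg_sub] at hzd
      linarith
    · have := norm_sub_norm_le (g z) (φ.symm (meshPoint δ c.1))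
      linarith
  obtain ⟨qu, Qu, hqu, hquB, hquim, hqud, hQuB, hQuA⟩ := hconn u huD hubd hur₁ hur₂
  obtain ⟨qv, Qv, hqv, hqvB, hqvim, hqvd, hQvB, hQvA⟩ := hconn v hvD hvbd hvr₁ hvr₂
  have hqu_arg : arg (g qu) = Real.pi :=
    arg_eq_pi_iff.2 ⟨re_neg_of_near hm0 hm3 hur₁ hure hquim hqud, hquim⟩
  have hqv_arg : arg (g qv) = 0 := by
    refine arg_eq_zero_iff.2 ⟨?_, hqvim⟩
    have hneg : (-(g qv)).re < 0 := by
      refine re_neg_of_near (G := -(φ.symm (meshPoint δ v.1))) hm0 hm3 (by rwa [norm_neg])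
        (by simpa using hvre) (by simpa using hqvim) ?_
      rwa [dist_neg_neg]
    simp only [neg_re, neg_lt_zero] at hneg
    exact hneg.le
  -- the cross-cut `L` from `qv` to `qu` and its image `β` in log-polar chart coordinates
  set L : Path qv qu := (Qv.symm.trans (walkPath emb p).symm).trans Qu with hL
  have hLrange : range L = (range Qv ∪ range (walkPath emb p)) ∪ range Qu := by
    simp only [hL, Path.trans_range, Path.symm_range]
  set S : Set ℂ := {z | z ∈ B ∧ ρ ≤ ‖g z‖ ∧ ‖g z‖ ≤ M * ρ} with hS
  have hLS : ∀ t, L.extend t ∈ S := by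
    intro t
    have ht : L.extend t ∈ range L := by rw [← Path.extend_range]; exact mem_range_self t
    rw [hLrange] at ht
    rcases ht with (ht | ht) | ht
    · exact hQvB _ ht
    · exact hpchart _ ht
    · exact hQuB _ ht
  have hSB : S ⊆ B := fun z hz => hz.1
  have hgS : MapsTo g S {w : ℂ | w ≠ 0 ∧ 0 ≤ w.im} := fun z hz =>
    ⟨fun h => by have := hz.2.1; rw [h, norm_zero] at this; linarith, hgim z hz.1⟩
  have hpolg : ContinuousOn (fun z => pol (g z)) S := continuousOn_pol.comp (hgB.mono hSB) hgS
  have hrect : ∀ z ∈ S, pol (g z) ∈ Icc (Real.log ρ) (Real.log (M * ρ)) ×ℂ Icc 0 Real.pi := fun z hz =>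
    pol_mem_rect hρ hz.2.1 hz.2.2 (hgim z hz.1)
  set β : ℝ → ℂ := fun t => pol (g (L.extend t)) with hβ
  have hβc : ContinuousOn β (Icc 0 1) :=
    hpolg.comp L.continuous_extend.continuousOn fun t _ => hLS t
  have hβK : MapsTo β (Icc 0 1) (Icc (Real.log ρ) (Real.log (M * ρ)) ×ℂ Icc 0 Real.pi) :=
    fun t _ => hrect _ (hLS t)
  have hβ0 : (β 0).im = 0 := by simp only [hβ, Path.extend_zero, pol_im]; exact hqv_arg
  have hβ1 : (β 1).im = Real.pi := by simp only [hβ, Path.extend_one, pol_im]; exact hqu_arg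
  -- the escaping walk `q`: prefix up to the first exit, trimmed in the chart, image `γ`
  obtain ⟨w, q₁, hw, hq₁d, hq₁s⟩ := exists_prefix_darts (fun z => z ∈ In ∪ Ann) q hb₀
  have hq0 : 0 < q₁.length := by
    rcases Nat.eq_zero_or_pos q₁.length with h | h
    · exact absurd (Or.inl ha₀ : a₀ ∈ In ∪ Ann) (Walk.eq_of_length_eq_zero h ▸ hw)
    · exact h
  have hq₁rad : ∀ e ∈ q₁.darts, ‖φ.symm (meshPoint δ e.fst.1)‖ ≤ M * ρ := by
    intro e he
    rcases hq₁d e he with h | h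
    · exact h.2.trans (by nlinarith)
    · exact h.2.2.le
  have hqchart : ∀ z ∈ range (walkPath emb q₁), z ∈ B := fun z hz =>
    (hpolyB q₁ hq0 hq₁rad z hz).choose_spec.2.2.1
  -- endpoints
  have ha₀r : meshPoint δ a₀.1 ∈ range (walkPath emb q₁) := ⟨0, (walkPath emb q₁).source⟩
  have hwr : meshPoint δ w.1 ∈ range (walkPath emb q₁) := ⟨1, (walkPath emb q₁).target⟩
  obtain ⟨-, ha₀D⟩ := hvert q₁ hq0 a₀ ha₀r
  obtain ⟨-, hwD⟩ := hvert q₁ hq0 w hwr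
  have ha₀ρ : ‖g (meshPoint δ a₀.1)‖ ≤ ρ := by rw [hgeq ha₀D]; exact ha₀.2
  have hwρ : M * ρ ≤ ‖g (meshPoint δ w.1)‖ := by
    rw [hgeq hwD]
    by_contra h
    push Not at h
    have hwball := hinball _ hwD h
    rcases le_or_gt ‖φ.symm (meshPoint δ w.1)‖ ρ with h' | h'
    · exact hw (Or.inl ⟨hwball, h'⟩)
    · exact hw (Or.inr ⟨hwball, h', h⟩)
  -- trimming
  set Γ : ℝ → ℂ := ⇑((walkPath emb q₁).extend) with hΓ
  have hΓB : ∀ t, Γ t ∈ B := fun t => hqchart _ (by rw [hΓ, ← Path.extend_range]; exact mem_range_self t)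
  set 𝒜 : Set ℂ := B ∩ g ⁻¹' closedBall 0 ρ with h𝒜
  set ℬ : Set ℂ := B ∩ g ⁻¹' {w | M * ρ ≤ ‖w‖} with hℬ
  have h𝒜c : IsClosed 𝒜 := hgB.preimage_isClosed_of_isClosed hBc.isClosed isClosed_closedBall
  have hℬc : IsClosed ℬ :=
    hgB.preimage_isClosed_of_isClosed hBc.isClosed (isClosed_le continuous_const continuous_norm)
  have hΓ0 : Γ 0 = meshPoint δ a₀.1 := (walkPath emb q₁).extend_zero
  have hΓ1 : Γ 1 = meshPoint δ w.1 := (walkPath emb q₁).extend_one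
  obtain ⟨u₁, v₁, hu₁0, hu₁v₁, hv₁1, hΓu₁, hΓv₁, hΓint⟩ :=
    exists_trimmed_interval (Γ := Γ) (walkPath emb q₁).continuous_extend h𝒜c hℬc zero_lt_one
      (show Γ 0 ∈ 𝒜 from ⟨hΓB 0, by rw [mem_preimage, hΓ0]; exact mem_closedBall_zero_iff.2 ha₀ρ⟩)
      (show Γ 1 ∈ ℬ from ⟨hΓB 1, by rw [mem_preimage, hΓ1]; exact hwρ⟩)
      (fun x _ hxA hxB => by
        have h1' : ‖g (Γ x)‖ ≤ ρ := mem_closedBall_zero_iff.1 hxA.2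
        have h2' : M * ρ ≤ ‖g (Γ x)‖ := hxB.2
        nlinarith)
  have hΓS : ∀ x ∈ Icc u₁ v₁, Γ x ∈ S := by
    -- the set of good parameters is closed and contains the open interval
    set T : Set ℝ := Icc u₁ v₁ ∩ (fun x => ‖g (Γ x)‖) ⁻¹' Icc ρ (M * ρ) with hT
    have hclosed : IsClosed T := by
      have hc : ContinuousOn (fun x => ‖g (Γ x)‖) (Icc u₁ v₁) :=
        continuous_norm.comp_continuousOn
          (hgB.comp (walkPath emb q₁).continuous_extend.continuousOn fun x _ => hΓB x)
      exact hc.preimage_isClosed_of_isClosed isClosed_Icc isClosed_Icc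
    have hsub : Ioo u₁ v₁ ⊆ T := by
      intro x hx
      obtain ⟨hxA, hxB⟩ := hΓint x hx
      refine ⟨Ioo_subset_Icc_self hx, ?_, ?_⟩
      · by_contra h; push Not at h
        exact hxA ⟨hΓB x, mem_closedBall_zero_iff.2 h.le⟩
      · by_contra h; push Not at h
        exact hxB ⟨hΓB x, h.le⟩
    have hcl : closure (Ioo u₁ v₁) ⊆ T := closure_minimal hsub hclosed
    rw [closure_Ioo hu₁v₁.ne] at hcl
    intro x hx
    exact ⟨hΓB x, (hcl hx).2⟩
  have hΓu₁' : ‖g (Γ u₁)‖ = ρ :=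
    le_antisymm (mem_closedBall_zero_iff.1 hΓu₁.2) (hΓS u₁ (left_mem_Icc.2 hu₁v₁.le)).2.1
  have hΓv₁' : ‖g (Γ v₁)‖ = M * ρ := le_antisymm (hΓS v₁ (right_mem_Icc.2 hu₁v₁.le)).2.2 hΓv₁.2
  set γc : ℝ → ℂ := fun s' => Γ (u₁ + s' * (v₁ - u₁)) with hγc
  have hγcmem : ∀ s' ∈ Icc (0 : ℝ) 1, u₁ + s' * (v₁ - u₁) ∈ Icc u₁ v₁ := by
    intro s' hs'
    constructor <;> nlinarith [hs'.1, hs'.2, hu₁v₁]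
  set γ : ℝ → ℂ := fun s' => pol (g (γc s')) with hγ
  have hγcc : Continuous γc := (walkPath emb q₁).continuous_extend.comp (by fun_prop)
  have hγc' : ContinuousOn γ (Icc 0 1) := hpolg.comp hγcc.continuousOn fun s' hs' => hΓS _ (hγcmem s' hs')
  have hγK : MapsTo γ (Icc 0 1) (Icc (Real.log ρ) (Real.log (M * ρ)) ×ℂ Icc 0 Real.pi) :=
    fun s' hs' => hrect _ (hΓS _ (hγcmem s' hs'))
  have hγ0 : (γ 0).re = Real.log ρ := by simp [hγ, hγc, hΓu₁']
  have hγ1 : (γ 1).re = Real.log (M * ρ) := by simp [hγ, hγc, hΓv₁']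
  -- the two curves meet: a common point of the cross-cut and of the polyline of `q₁`
  obtain ⟨s', hs', t, -, hst⟩ := exists_mem_of_crossing hβc hγc' hβK hγK hβ0 hβ1 hγ0 hγ1
  have hzS : L.extend t ∈ S := hLS t
  have hz'S : γc s' ∈ S := hΓS _ (hγcmem s' hs')
  have hgzz : g (L.extend t) = g (γc s') := injOn_pol (hgS hzS) (hgS hz'S) hst
  have hzz : L.extend t = γc s' := hginj (hBsub hzS.1) (hBsub hz'S.1) hgzz
  set z := L.extend t with hzdef
  have hzL : z ∈ range L := by rw [← Path.extend_range]; exact mem_range_self t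
  have hzq : z ∈ range (walkPath emb q₁) := by
    rw [hzz, hγc, hΓ, ← Path.extend_range]; exact mem_range_self _
  obtain ⟨e', he', hze'⟩ := exists_dart_of_mem_range_walkPath q₁ hq0 hzq
  obtain ⟨-, -, hzd', -, hx'v, hy'v, hm', -⟩ := hdartD e'.adj
  -- a vertex of `q₁` on the support of `p` is the sought contradiction
  have hcontra : ∀ c : Λ, c ∈ p.support → c ∈ q₁.support → False := fun c hcp hcq =>
    hcon c (hq₁s hcq) hcp
  -- points of the connectors other than their lattice end avoid the mesh
  have havoid : ∀ z₀ : ℂ, Mesh.AvoidsMesh D.carrier δ z₀ →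
      z₀ ∉ segment ℝ (meshPoint δ e'.fst.1) (meshPoint δ e'.snd.1) := fun z₀ hz₀ =>
    hz₀.2 _ hx'v _ hy'v hm'
  rw [hLrange] at hzL
  rcases hzL with (hzL | hzL) | hzL
  · -- on the connector at `v`
    by_cases hzv : z = meshPoint δ v.1
    · obtain ⟨hvq, -⟩ := hvert q₁ hq0 v (hzv ▸ hzq)
      exact hcontra v p.end_mem_support hvq
    · exact havoid z (hQvA z hzL hzv) hze'
  · -- on the polyline of `p`: two lattice edges meet at a common endpoint
    obtain ⟨e, he, hze⟩ := exists_dart_of_mem_range_walkPath p hp0 hzL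
    obtain ⟨-, -, hzd, -⟩ := hdartD e.adj
    obtain ⟨mm, hm1', hm2'⟩ := exists_common_endpoint hδ0 hzd hzd' hze hze'
    have h1' : ∃ c ∈ p.support, c.1 = mm := by
      rcases hm1' with rfl | rfl
      · exact ⟨_, p.dart_fst_mem_support_of_mem_darts he, rfl⟩
      · exact ⟨_, p.dart_snd_mem_support_of_mem_darts he, rfl⟩
    have h2' : ∃ c ∈ q₁.support, c.1 = mm := by
      rcases hm2' with rfl | rfl
      · exact ⟨_, q₁.dart_fst_mem_support_of_mem_darts he', rfl⟩
      · exact ⟨_, q₁.dart_snd_mem_support_of_mem_darts he', rfl⟩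
    obtain ⟨c, hc, hcm⟩ := h1'
    obtain ⟨c', hc', hc'm⟩ := h2'
    have : c = c' := Subtype.ext (hcm.trans hc'm.symm)
    exact hcontra c hc (this ▸ hc')
  · -- on the connector at `u`
    by_cases hzu : z = meshPoint δ u.1
    · obtain ⟨huq, -⟩ := hvert q₁ hq0 u (hzu ▸ hzq)
      exact hcontra u p.start_mem_support huq
    · exact havoid z (hQuA z hzL hzu) hze'

end Summit.CriticalPhenomena.SAWScalingLimit.Theorems.IsingBoundaryRatio

end
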